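import Literature.NumberTheory.Transcendental.CubeChartBasics
import Mathlib.Analysis.SpecialFunctions.Log.Deriv
import Mathlib.Analysis.SpecialFunctions.ExpDeriv
import Mathlib.LinearAlgebra.Matrix.NonsingularInverse
import HarnessLib

/-!
# Monomial (toric) charts of the unit cube

For `A ∈ ℕ^{n×n}` the monomial map `μ_A : ℝⁿ → ℝⁿ`, `μ_A(v)ᵢ = ∏ⱼ vⱼ^{A i j}` (the real points of
the toric morphism of the cone spanned by the rows of `A`; Fulton 1993, §2.6, in multiplicative
coordinates). Recorded here, with `K = [0,1]ⁿ` and `O = (0,1)ⁿ`: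

* `μ_A` is a polynomial map: analytic and `ℚ`-semialgebraic; it maps `K` into `K`, and `O` into `O`
  as soon as `A` has no zero row (e.g. `det A ≠ 0`);
* if `det A ≠ 0` (over `ℝ`), `μ_A` has the left inverse `y ↦ exp(A⁻¹ log y)` on the open positive
  orthant, hence is injective there with `det Dμ_A ≠ 0`;
* **monomials pull back to monomials**: `∏ᵢ (μ_A v)ᵢ^{pᵢ} = ∏ⱼ vⱼ^{(Aᵀp)ⱼ}`,
  `(Aᵀp)ⱼ = ∑ᵢ A i j · pᵢ`.

Unimodularity is irrelevant for these real-analytic statements. No definitions (the map is a lambda).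

## References

* W. Fulton, *Introduction to Toric Varieties* (1993), §2.6.
* M. Kontsevich, D. Zagier, *Periods* (2001), §1.2.
-/

noncomputable section

open Set Filter Topology MvPolynomial
open Literature.ModelTheory.ExponentialFields (IsSemialgebraic)

namespace Literature.NumberTheory.Transcendental

variable {n : ℕ}

/-! ### Monomial maps are polynomial maps of the cube -/

/-- Monomial maps are analytic. [folklore] -/
theorem analyticAt_monomialMap (A : Matrix (Fin n) (Fin n) ℕ) (x : Fin n → ℝ) :
    AnalyticAt ℝ (fun (v : Fin n → ℝ) (i : Fin n) => ∏ j, v j ^ A i j) x :=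
  AnalyticAt.pi fun i => analyticAt_prod_pow (fun j => A i j) x

/-- Monomial maps are continuous. [folklore] -/
theorem continuous_monomialMap (A : Matrix (Fin n) (Fin n) ℕ) :
    Continuous (fun (v : Fin n → ℝ) (i : Fin n) => ∏ j, v j ^ A i j) :=
  continuous_pi fun _ => continuous_finsetProd _ fun j _ => (continuous_apply j).pow _

/-- Monomial maps are `ℚ`-semialgebraic on every `ℚ`-semialgebraic set. [folklore] -/
theorem isSemialgebraicMapOn_monomialMap (A : Matrix (Fin n) (Fin n) ℕ) {s : Set (Fin n → ℝ)}
    (hs : IsSemialgebraic ℚ s) :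
    IsSemialgebraicMapOn ℚ s (fun (v : Fin n → ℝ) (i : Fin n) => ∏ j, v j ^ A i j) :=
  (isSemialgebraicMapOn_aeval hs fun i => ∏ j, X j ^ A i j).congr fun v _ => by
    funext i
    simp [map_prod]

/-- `μ_A` maps the closed cube into itself. [folklore] -/
theorem monomialMap_mapsTo_pi_Icc (A : Matrix (Fin n) (Fin n) ℕ) :
    MapsTo (fun (v : Fin n → ℝ) (i : Fin n) => ∏ j, v j ^ A i j)
      (Set.pi Set.univ fun _ : Fin n => Set.Icc (0 : ℝ) 1)
      (Set.pi Set.univ fun _ : Fin n => Set.Icc (0 : ℝ) 1) := by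
  intro v hv
  simp only [Set.mem_univ_pi, Set.mem_Icc] at hv ⊢
  exact fun i => ⟨Finset.prod_nonneg fun j _ => pow_nonneg (hv j).1 _,
    Finset.prod_le_one (fun j _ => pow_nonneg (hv j).1 _) fun j _ => pow_le_one₀ (hv j).1 (hv j).2⟩

/-- `μ_A` maps the open cube into itself when `det A ≠ 0`. [folklore] -/
theorem monomialMap_mapsTo_pi_Ioo {A : Matrix (Fin n) (Fin n) ℕ}
    (hA : (A.map (fun t : ℕ => (t : ℝ))).det ≠ 0) :
    MapsTo (fun (v : Fin n → ℝ) (i : Fin n) => ∏ j, v j ^ A i j)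
      (Set.pi Set.univ fun _ : Fin n => Set.Ioo (0 : ℝ) 1)
      (Set.pi Set.univ fun _ : Fin n => Set.Ioo (0 : ℝ) 1) := by
  intro v hv
  simp only [Set.mem_univ_pi, Set.mem_Ioo] at hv ⊢
  intro i
  refine ⟨Finset.prod_pos fun j _ => pow_pos (hv j).1 _, ?_⟩
  -- `det A ≠ 0` forbids a zero row
  obtain ⟨j, hj⟩ : ∃ j, A i j ≠ 0 := by
    by_contra h
    simp only [not_exists, not_not] at h
    exact hA (Matrix.det_eq_zero_of_row_eq_zero i fun j => by simp [h j])
  rw [← Finset.mul_prod_erase Finset.univ (fun j => v j ^ A i j) (Finset.mem_univ j)]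
  have h1 : v j ^ A i j < 1 := pow_lt_one₀ (hv j).1.le (hv j).2 hj
  have h2 : ∏ k ∈ Finset.univ.erase j, v k ^ A i k ≤ 1 :=
    Finset.prod_le_one (fun k _ => pow_nonneg (hv k).1.le _) fun k _ =>
      pow_le_one₀ (hv k).1.le (hv k).2.le
  calc v j ^ A i j * ∏ k ∈ Finset.univ.erase j, v k ^ A i k ≤ v j ^ A i j * 1 :=
        mul_le_mul_of_nonneg_left h2 (pow_nonneg (hv j).1.le _)
    _ < 1 := by rw [mul_one]; exact h1

/-- `μ_A` has positive coordinates at points with positive coordinates. [folklore] -/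
theorem monomialMap_pos (A : Matrix (Fin n) (Fin n) ℕ) {v : Fin n → ℝ} (hv : ∀ j, 0 < v j)
    (i : Fin n) : 0 < ∏ j, v j ^ A i j :=
  Finset.prod_pos fun j _ => pow_pos (hv j) _

/-! ### The logarithmic left inverse -/

/-- **Left inverse of a monomial map.** For `det A ≠ 0` and `v` in the open positive orthant,
`exp(A⁻¹ · log(μ_A v)) = v` coordinatewise. [folklore] -/
theorem monomialInv_monomialMap {A : Matrix (Fin n) (Fin n) ℕ}
    (hA : (A.map (fun t : ℕ => (t : ℝ))).det ≠ 0) {v : Fin n → ℝ} (hv : ∀ j, 0 < v j) :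
    (fun (y : Fin n → ℝ) (i : Fin n) =>
        Real.exp (∑ j, (A.map (fun t : ℕ => (t : ℝ)))⁻¹ i j * Real.log (y j)))
      ((fun (v : Fin n → ℝ) (i : Fin n) => ∏ j, v j ^ A i j) v) = v := by
  funext i
  have hlog : ∀ j, Real.log (∏ k, v k ^ A j k) =
      ∑ k, (A.map (fun t : ℕ => (t : ℝ))) j k * Real.log (v k) := by
    intro j
    rw [Real.log_prod (s := Finset.univ) fun k _ => (pow_pos (hv k) _).ne']
    exact Finset.sum_congr rfl fun k _ => by rw [Real.log_pow, Matrix.map_apply]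
  have hsum : ∑ j, (A.map (fun t : ℕ => (t : ℝ)))⁻¹ i j *
      ∑ k, (A.map (fun t : ℕ => (t : ℝ))) j k * Real.log (v k) = Real.log (v i) := by
    calc ∑ j, (A.map (fun t : ℕ => (t : ℝ)))⁻¹ i j * ∑ k, (A.map (fun t : ℕ => (t : ℝ))) j k *
          Real.log (v k)
        = ∑ k, ((A.map (fun t : ℕ => (t : ℝ)))⁻¹ * A.map (fun t : ℕ => (t : ℝ))) i k *
            Real.log (v k) := by
          simp only [Matrix.mul_apply, Finset.sum_mul, Finset.mul_sum]
          rw [Finset.sum_comm]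
          exact Finset.sum_congr rfl fun k _ => Finset.sum_congr rfl fun j _ => by ring
      _ = Real.log (v i) := by
          rw [Matrix.nonsing_inv_mul _ (isUnit_iff_ne_zero.2 hA)]
          simp [Matrix.one_apply]
  simp only [hlog]
  rw [hsum, Real.exp_log (hv i)]

/-- The logarithmic inverse is differentiable on the open positive orthant. [folklore] -/
theorem differentiableAt_monomialInv (B : Matrix (Fin n) (Fin n) ℝ) {y : Fin n → ℝ}
    (hy : ∀ j, 0 < y j) :
    DifferentiableAt ℝ
      (fun (y : Fin n → ℝ) (i : Fin n) => Real.exp (∑ j, B i j * Real.log (y j))) y := by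
  refine differentiableAt_pi.2 fun i => ?_
  refine DifferentiableAt.exp (DifferentiableAt.fun_sum fun j _ => ?_)
  exact (differentiableAt_const _).mul ((differentiableAt_apply j y).log (hy j).ne')

/-- **Monomial maps with `det A ≠ 0` are injective on the open positive orthant.** [folklore] -/
theorem injOn_monomialMap {A : Matrix (Fin n) (Fin n) ℕ}
    (hA : (A.map (fun t : ℕ => (t : ℝ))).det ≠ 0) :
    InjOn (fun (v : Fin n → ℝ) (i : Fin n) => ∏ j, v j ^ A i j) {v | ∀ j, 0 < v j} :=
  LeftInvOn.injOn
    (f₁' := fun (y : Fin n → ℝ) (i : Fin n) =>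
      Real.exp (∑ j, (A.map (fun t : ℕ => (t : ℝ)))⁻¹ i j * Real.log (y j)))
    fun _ hv => monomialInv_monomialMap hA hv

/-- **Monomial maps with `det A ≠ 0` have non-vanishing Jacobian determinant on the open positive
orthant** (`det Dμ_A(v) = det A · ∏ᵢ (μ_A v)ᵢ / ∏ⱼ vⱼ`; here via the logarithmic left inverse).
[folklore] -/
theorem det_fderiv_monomialMap_ne_zero {A : Matrix (Fin n) (Fin n) ℕ}
    (hA : (A.map (fun t : ℕ => (t : ℝ))).det ≠ 0) {v : Fin n → ℝ} (hv : ∀ j, 0 < v j) :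
    (fderiv ℝ (fun (v : Fin n → ℝ) (i : Fin n) => ∏ j, v j ^ A i j) v).det ≠ 0 := by
  have hopen : IsOpen {v : Fin n → ℝ | ∀ j, 0 < v j} := by
    rw [show {v : Fin n → ℝ | ∀ j, 0 < v j} = ⋂ j, {v | 0 < v j} by ext; simp]
    exact isOpen_iInter_of_finite fun j => isOpen_lt continuous_const (continuous_apply j)
  exact det_fderiv_ne_zero_of_leftInverse (analyticAt_monomialMap A v).differentiableAt
    (differentiableAt_monomialInv _ (monomialMap_pos A hv))
    (Filter.Eventually.mono (hopen.mem_nhds hv) fun _ hw => monomialInv_monomialMap hA hw)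

/-- Injectivity on the open cube. [folklore] -/
theorem injOn_monomialMap_pi_Ioo {A : Matrix (Fin n) (Fin n) ℕ}
    (hA : (A.map (fun t : ℕ => (t : ℝ))).det ≠ 0) :
    InjOn (fun (v : Fin n → ℝ) (i : Fin n) => ∏ j, v j ^ A i j)
      (Set.pi Set.univ fun _ : Fin n => Set.Ioo (0 : ℝ) 1) :=
  (injOn_monomialMap hA).mono fun _ hv j => ((Set.mem_univ_pi.1 hv) j).1

/-- Non-vanishing Jacobian determinant on the open cube. [folklore] -/
theorem det_fderiv_monomialMap_ne_zero_of_mem_pi_Ioo {A : Matrix (Fin n) (Fin n) ℕ}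
    (hA : (A.map (fun t : ℕ => (t : ℝ))).det ≠ 0) {v : Fin n → ℝ}
    (hv : v ∈ Set.pi Set.univ fun _ : Fin n => Set.Ioo (0 : ℝ) 1) :
    (fderiv ℝ (fun (v : Fin n → ℝ) (i : Fin n) => ∏ j, v j ^ A i j) v).det ≠ 0 :=
  det_fderiv_monomialMap_ne_zero hA fun j => ((Set.mem_univ_pi.1 hv) j).1

/-! ### Monomials pull back to monomials -/

/-- **Pull-back of monomials along a monomial map**: if `yᵢ = ∏ⱼ vⱼ^{A i j}` then
`∏ᵢ yᵢ^{pᵢ} = ∏ⱼ vⱼ^{∑ᵢ A i j pᵢ}`. [folklore] -/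
theorem prod_pow_monomialMap (A : Matrix (Fin n) (Fin n) ℕ) (p : Fin n → ℕ) {y v : Fin n → ℝ}
    (hy : ∀ i, y i = ∏ j, v j ^ A i j) :
    (∏ i, y i ^ p i) = ∏ j, v j ^ (∑ i, A i j * p i) := by
  simp only [hy, ← Finset.prod_pow, ← pow_mul]
  rw [Finset.prod_comm]
  exact Finset.prod_congr rfl fun j _ => Finset.prod_pow_eq_pow_sum _ _ _

/-- Transposed exponents are additive in the exponent: `Aᵀ(2p) = 2 Aᵀp`. [folklore] -/
theorem sum_mul_two_nsmul (A : Matrix (Fin n) (Fin n) ℕ) (p : Fin n → ℕ) (j : Fin n) :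
    ∑ i, A i j * (2 • p) i = 2 * ∑ i, A i j * p i := by
  rw [Finset.mul_sum]
  exact Finset.sum_congr rfl fun i _ => by rw [Pi.smul_apply, smul_eq_mul]; ring

end Literature.NumberTheory.Transcendental
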